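import Mathlib
import Literature.MathematicalPhysics.QuantumFieldTheory.Balaban1983to89.B12Beta
import Literature.MathematicalPhysics.QuantumFieldTheory.Balaban1983to89.B12Sec2to5
import Literature.MathematicalPhysics.QuantumFieldTheory.Balaban1983to89.Beta.DecimatedMomentSummable
import Literature.MathematicalPhysics.QuantumFieldTheory.Balaban1983to89.Beta.DressedMomentNormalisation

/-!
# Road «FP» (binder row D1), N2-inherit socket: the step defect at the FIXED POINT inherits (SDF) from the finite levels

Road FP's END (`FP/StepLawKHolds.d1Drift_JsBalOf_of_rows_bounded`, `FP/RoadPinnedHolds.…`) asks, for the perfect `m`-fold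
one-loop kernels `TP m` and the transported one-step kernels `RP m` (the `(Lc^m)^8 · dressedEntry (colOf KPerf m) (TPerf 1) (Lc^m • ·)`
term), three binders about a free remainder family `D m`:
  `hfub : TP (m+1) = RP m + TP m + D m`,  `hDA : AbsMoment₂ (D m a b)`,  `hSDF : secondMoment (D m) μ ν = 0`.
OWNER RULING R-FP-5 (`HOME/b2b-balaban-beta-d1-p3/OWNER-RULINGS-FP-1.md`): take `D m :=` THE EXPLICIT DIFFERENCE, so `hfub` is
trivial and all content is `hSDF`; and `hSDF` INHERITS from the composed road's finite-level step identities (P6 / (SDF-α),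
owner an2/an4 lineages) by entrywise limits, exactly as N3 inherits from the hR/hW rows (`FP/SymmetryLimit`).

THIS FILE is that inheritance, generic over kernel families (`B12Beta.Kernel 4`-valued, [folklore] throughout):
* §1 `tendsto_secondMoment_of_decay510` — Tannery for the (1.22)-second moment under a `j`-uniform `Decay510` majorant;
  `secondMoment_eq_zero_of_tendsto`; `absMoment₂_of_tendsto_decay510`.
* §2 **`stepDefect_inherit`** — finite-level identities `Tj j (m+1) = Rj j m + Tj j m + Dj j m` with
  `secondMoment (Dj j m) μ ν = 0`, entrywise convergence `Tj j m → TP m`, `Rj j m → RP m`, and a `j`-uniform exponential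
  majorant for the defects ⟹ with `D m := TP (m+1) − RP m − TP m`: `hfub` (rfl-level), `hDA`, `hSDF`.
Nothing about Bałaban's operators is asserted; the finite-level identities and the convergences are HYPOTHESES (their
suppliers: an4's `StepRecursion`/(SDF) at level `j` for the composite `(j,·)` families, and X1m).
HONEST FRAMING: bookkeeping toward `hident` (GAPS O-asym1-7); discharges nothing of `BetaPertH`; NOT the continuum limit, NOT Clay.
-/

noncomputable section

open Filter Topology
open scoped BigOperators

namespace Summit.QuantumFields.BalabanUV.Beta.FP.StepDefectInherit

open Literature.MathematicalPhysics.QuantumFieldTheory.Balaban1983to89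
open Literature.MathematicalPhysics.QuantumFieldTheory.Balaban1983to89.B12Sec2to5 (l1 l1_nonneg Decay510
  abs_term_le_of_decay510 majorant_summable secondMoment_abs_le_of_decay510)
open Literature.MathematicalPhysics.QuantumFieldTheory.Balaban1983to89.Beta.DecimatedMomentSummable (AbsMoment₂ absMoment₂_of_decay510)

variable {d : ℕ}

/-! ## §1 Tannery for the (1.22)-second moment -/

/-- [folklore] **Second moments pass to entrywise limits under a uniform exponential majorant** (dominated convergence on `ℤ^d`). -/
theorem tendsto_secondMoment_of_decay510 {P : ℕ → B12Beta.Kernel d} {Pinf : B12Beta.Kernel d} {μ ν : Fin d} {C δ : ℝ}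
    (hδ : 0 < δ) (hU : ∀ j, Decay510 (P j μ ν) C δ) (hlim : ∀ x, Tendsto (fun j => P j μ ν x) atTop (𝓝 (Pinf μ ν x))) :
    Tendsto (fun j => B12Beta.secondMoment (P j) μ ν) atTop (𝓝 (B12Beta.secondMoment Pinf μ ν)) := by
  unfold B12Beta.secondMoment
  refine tendsto_tsum_of_dominated_convergence (bound := fun x : Fin d → ℤ => C * (l1 x ^ 2 * Real.exp (-δ * l1 x)))
    ((majorant_summable hδ d).mul_left C) (fun x => ?_) (Eventually.of_forall fun j x => ?_)
  · exact ((hlim x).mul_const _).mul_const _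
  · rw [Real.norm_eq_abs]
    exact abs_term_le_of_decay510 (hU j) μ ν x

/-- [folklore] If every member has vanishing `(μ,ν)`-second moment, so has the limit. -/
theorem secondMoment_eq_zero_of_tendsto {P : ℕ → B12Beta.Kernel d} {Pinf : B12Beta.Kernel d} {μ ν : Fin d} {C δ : ℝ}
    (hδ : 0 < δ) (hU : ∀ j, Decay510 (P j μ ν) C δ) (hlim : ∀ x, Tendsto (fun j => P j μ ν x) atTop (𝓝 (Pinf μ ν x)))
    (hzero : ∀ j, B12Beta.secondMoment (P j) μ ν = 0) : B12Beta.secondMoment Pinf μ ν = 0 := by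
  have h := tendsto_secondMoment_of_decay510 hδ hU hlim
  simp only [hzero] at h
  exact tendsto_nhds_unique h tendsto_const_nhds

/-- [folklore] A uniform exponential majorant passes to the entrywise limit, hence the limit has an absolutely summable second moment. -/
theorem absMoment₂_of_tendsto_decay510 {f : ℕ → (Fin d → ℤ) → ℝ} {finf : (Fin d → ℤ) → ℝ} {C δ : ℝ} (hδ : 0 < δ)
    (hU : ∀ j, Decay510 (f j) C δ) (hlim : ∀ x, Tendsto (fun j => f j x) atTop (𝓝 (finf x))) : AbsMoment₂ finf := by
  have hdec : Decay510 finf C δ := fun x =>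
    le_of_tendsto ((continuous_abs.tendsto _).comp (hlim x)) (Eventually.of_forall fun j => hU j x)
  exact absMoment₂_of_decay510 hδ hdec

/-! ## §2 The socket: `hfub` / `hDA` / `hSDF` at the fixed point from the finite-level step identities -/

section Socket

variable {Tj Rj Dj : ℕ → ℕ → B12Beta.Kernel 4} {TP RP : ℕ → B12Beta.Kernel 4}

/-- [our object] The step defect AT THE FIXED POINT: the explicit difference `D m := TP (m+1) − RP m − TP m`. -/
def defect (TP RP : ℕ → B12Beta.Kernel 4) (m : ℕ) : B12Beta.Kernel 4 :=
  fun a b z => TP (m + 1) a b z - RP m a b z - TP m a b z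

/-- [our object] `hfub` is definitional for the explicit difference. -/
theorem fubini_defect (m : ℕ) (a b : Fin 4) (z : Fin 4 → ℤ) :
    TP (m + 1) a b z = RP m a b z + TP m a b z + defect TP RP m a b z := by
  unfold defect; ring

/-- [folklore] The finite-level defects converge entrywise to the fixed-point defect. -/
theorem tendsto_defect (hfin : ∀ j m, 1 ≤ m → ∀ a b z, Tj j (m + 1) a b z = Rj j m a b z + Tj j m a b z + Dj j m a b z)
    (hT : ∀ m a b z, Tendsto (fun j => Tj j m a b z) atTop (𝓝 (TP m a b z)))
    (hR : ∀ m, 1 ≤ m → ∀ a b z, Tendsto (fun j => Rj j m a b z) atTop (𝓝 (RP m a b z)))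
    {m : ℕ} (hm : 1 ≤ m) (a b : Fin 4) (z : Fin 4 → ℤ) :
    Tendsto (fun j => Dj j m a b z) atTop (𝓝 (defect TP RP m a b z)) := by
  have e : ∀ j, Dj j m a b z = Tj j (m + 1) a b z - Rj j m a b z - Tj j m a b z := fun j => by
    rw [hfin j m hm a b z]; ring
  simp_rw [e]
  exact ((hT (m + 1) a b z).sub (hR m hm a b z)).sub (hT m a b z)

/-- [folklore] **N2-INHERIT SOCKET.**  Finite-level step identities with (SDF) in the `(μ,ν)` channel, entrywise convergence of the
kernels and of the transported terms, and a `j`-uniform exponential majorant of the finite-level defects give road FP's three binders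
for the explicit difference `defect TP RP`: `hfub`, `hDA`, `hSDF`. -/
theorem stepDefect_inherit
    (hfin : ∀ j m, 1 ≤ m → ∀ a b z, Tj j (m + 1) a b z = Rj j m a b z + Tj j m a b z + Dj j m a b z)
    (hT : ∀ m a b z, Tendsto (fun j => Tj j m a b z) atTop (𝓝 (TP m a b z)))
    (hR : ∀ m, 1 ≤ m → ∀ a b z, Tendsto (fun j => Rj j m a b z) atTop (𝓝 (RP m a b z)))
    (hDdec : ∀ m, 1 ≤ m → ∀ a b, ∃ C δ : ℝ, 0 < δ ∧ ∀ j, Decay510 (Dj j m a b) C δ)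
    (μ ν : Fin 4) (hSDFj : ∀ j m, 1 ≤ m → B12Beta.secondMoment (Dj j m) μ ν = 0) :
    (∀ m, 1 ≤ m → ∀ a b z, TP (m + 1) a b z = RP m a b z + TP m a b z + defect TP RP m a b z)
      ∧ (∀ m, 1 ≤ m → ∀ a b, AbsMoment₂ (defect TP RP m a b))
      ∧ (∀ m, 1 ≤ m → B12Beta.secondMoment (defect TP RP m) μ ν = 0) := by
  refine ⟨fun m _ a b z => fubini_defect m a b z, fun m hm a b => ?_, fun m hm => ?_⟩
  · obtain ⟨C, δ, hδ, hU⟩ := hDdec m hm a b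
    exact absMoment₂_of_tendsto_decay510 hδ hU (fun z => tendsto_defect hfin hT hR hm a b z)
  · obtain ⟨C, δ, hδ, hU⟩ := hDdec m hm μ ν
    exact secondMoment_eq_zero_of_tendsto hδ hU (fun z => tendsto_defect hfin hT hR hm μ ν z) (fun j => hSDFj j m hm)

end Socket

end Summit.QuantumFields.BalabanUV.Beta.FP.StepDefectInherit

end
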